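import Summits.AtomisticToContinuum.FouriersLaw.Theorems.HonestZwanzigParityStatics

/-!
# `HonestZwanzig`: the contact (Robin) term of the Feshbach matrix from `ParityStatics`

Corollary file (`--supports` the crux `RobinCoercivity`, stmt-AtomisticToContinuum-12695, of route
`HonestZwanzig`; proved from the landed item `ParityStatics`, stmt-AtomisticToContinuum-12699).

The Feshbach matrix of the route is `𝔽_N(s)_{xy} = s·Cov(e_x,e_y) − Cov(e_x, L e_y) − schur_s(L†e_x, L e_y)`.
By `ParityStatics`, `Cov_μ(e_x, L e_y) = −γT²·[x = y ∈ {0, N−1}]` under the Gibbs measure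
`μ = gibbsMeasure N T` (`N ≥ 2`), so the middle block is EXACTLY the Robin boundary form:
`−∑_{x,y} ξ_x Cov(e_x, L e_y) ξ_y = γT² (ξ_0² + ξ_{N−1}²)` for every profile `ξ : Fin N → ℝ`
(`sum_sum_cov_splitSiteEnergy_generator`, stated over the route's `let`-bound objects and with the
Robin terms spelled as in `RobinCoercivity`). Newton cooling at the two contacts; the Euler block
`⟨e, j⟩` vanishes by parity (first clause of `ParityStatics`). [Bonetto–Lebowitz–Rey-Bellet 2000 §4.1;
Zwanzig 2001 Ch. 8]
-/

noncomputable section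

open MeasureTheory

namespace Summit.AtomisticToContinuum.FouriersLaw.Theorems.HonestZwanzig

open Literature.MathematicalPhysics.KineticTheory.HeatConduction

/-- Collapsing the diagonal indicator against a profile: for `N ≥ 2`,
`∑_x ∑_y ξ_x (−[x = y ∧ (x = 0 ∨ x = N−1)] c) ξ_y = −c ∑_i ([i = 0] ξ_i² + [i = N−1] ξ_i²)`. [folklore] -/
theorem sum_sum_neg_ite_diag_boundary {N : ℕ} (hN : 2 ≤ N) (c : ℝ) (ξ : Fin N → ℝ) :
    ∑ x : Fin N, ∑ y : Fin N, ξ x * (-(if x = y ∧ (x.val = 0 ∨ x.val = N - 1) then c else 0)) * ξ y =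
      -c * ∑ i : Fin N, ((if i.val = 0 then ξ i ^ 2 else 0) + (if i.val = N - 1 then ξ i ^ 2 else 0)) := by
  classical
  rw [Finset.mul_sum]
  refine Finset.sum_congr rfl fun x _ => ?_
  rw [Finset.sum_eq_single x]
  · have hx := x.isLt
    by_cases h0 : x.val = 0
    · have h1 : ¬ (x.val = N - 1) := by omega
      rw [if_pos (show x = x ∧ (x.val = 0 ∨ x.val = N - 1) from ⟨rfl, Or.inl h0⟩), if_pos h0, if_neg h1]
      ring
    · by_cases h1 : x.val = N - 1
      · rw [if_pos (show x = x ∧ (x.val = 0 ∨ x.val = N - 1) from ⟨rfl, Or.inr h1⟩), if_neg h0, if_pos h1]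
        ring
      · rw [if_neg (show ¬ (x = x ∧ (x.val = 0 ∨ x.val = N - 1)) from fun h => h.2.elim h0 h1),
          if_neg h0, if_neg h1]
        ring
  · intro y _ hyx
    rw [if_neg (show ¬ (x = y ∧ (x.val = 0 ∨ x.val = N - 1)) from fun h => hyx h.1.symm)]
    ring
  · intro h
    exact absurd (Finset.mem_univ x) h

/-- **The contact (Robin) block of the Feshbach matrix.** For `pinnedChain ω₂ lam β γ` (all parameters
`> 0`), `T > 0`, `N ≥ 2`, the Gibbs measure `μ = gibbsMeasure N T`, the split site energies `e_x` of the
route and every profile `ξ : Fin N → ℝ`: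
`∑_x ∑_y ξ_x Cov_μ(e_x, L_{T,T} e_y) ξ_y = −γT² ∑_i ([i = 0] ξ_i² + [i = N−1] ξ_i²)`,
i.e. `−ξᵀ Cov(e, Le) ξ` is the Robin boundary form `γT²(ξ_0² + ξ_{N−1}²)` appearing in `RobinCoercivity`
(from `ParityStatics`: `Cov(e_x, L e_y) = −γT²[x = y ∈ {0, N−1}]`). [folklore] -/
theorem sum_sum_cov_splitSiteEnergy_generator :
    ∀ ω₂ lam β γ : ℝ, 0 < ω₂ → 0 < lam → 0 < β → 0 < γ → ∀ T : ℝ, 0 < T → ∀ N : ℕ, 2 ≤ N →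
      let P := Literature.MathematicalPhysics.KineticTheory.HeatConduction.pinnedChain ω₂ lam β γ
      let X := Literature.MathematicalPhysics.KineticTheory.HeatConduction.PhaseSpace N
      let μ : MeasureTheory.Measure X := P.gibbsMeasure N T
      let e : Fin N → X → ℝ := fun x z => z.2 x ^ 2 / 2 + P.U (z.1 x) + ∑ j : Fin N,
        ((if j.val = x.val + 1 then P.V (z.1 j - z.1 x) / 2 else 0) +
          (if x.val = j.val + 1 then P.V (z.1 x - z.1 j) / 2 else 0))
      ∀ ξ : Fin N → ℝ,
        ∑ x : Fin N, ∑ y : Fin N, ξ x * ((∫ z, e x z * P.generator N T T (e y) z ∂μ) -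
          (∫ z, e x z ∂μ) * (∫ z, P.generator N T T (e y) z ∂μ)) * ξ y =
          -(P.γ * T ^ 2) * ∑ i : Fin N,
            ((if i.val = 0 then ξ i ^ 2 else 0) + (if i.val = N - 1 then ξ i ^ 2 else 0)) := by
  intro ω₂ lam β γ hω hl hβ hγ T hT N hN
  have hPS := parityStatics_proof ω₂ lam β γ hω hl hβ hγ T hT N hN
  dsimp only at hPS ⊢
  intro ξ
  rw [← sum_sum_neg_ite_diag_boundary hN ((pinnedChain ω₂ lam β γ).γ * T ^ 2) ξ]
  refine Finset.sum_congr rfl fun x _ => Finset.sum_congr rfl fun y _ => ?_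
  rw [(hPS x).2 y]

end Summit.AtomisticToContinuum.FouriersLaw.Theorems.HonestZwanzig

end
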